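import Mathlib.Analysis.InnerProductSpace.Calculus
import Mathlib.Analysis.SpecialFunctions.Sqrt
import Mathlib.Analysis.Calculus.FDeriv.Mul
import Mathlib.Analysis.Calculus.Deriv.Basic
import Mathlib.Analysis.Calculus.Deriv.Inv
import Literature.Analysis.Potential.HyperbolicBallPoissonProofs

/-!
# First and second derivatives of radial functions `y ↦ g(‖y‖)`

Topic `Geometry/Riemannian` (fact seat
`provefact-Literature.Geometry.Riemannian.LawsonMichelsohn1984_surrounding`).  Everything here
is **proved**; no definitions.

The bent hypersurfaces of the surrounding construction (Lawson–Michelsohn 1984, §3) are level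
sets of functions of the distance `r = ‖y‖` to a core (`t - τ(‖y‖)`, `‖y‖² - ρ(t)²`); their mean
convexity is read off the Hessian of radial functions.  For a real inner product space `F`, a
point `y ≠ 0` with `r = ‖y‖`, `ŷ = r⁻¹ y`, and `g : ℝ → ℝ`:

* `hasFDerivAt_radial` — `d(g ∘ ‖·‖)(y) = g'(r) ⟨ŷ, ·⟩` (from the tree's
  `Literature.Analysis.Potential.HyperbolicBall.hasFDerivAt_norm_of_ne_zero`, `d‖·‖(y) = ⟨ŷ, ·⟩`);
* `hasFDerivAt_fderiv_radial`, `fderiv_fderiv_radial_apply` — **the radial Hessian**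
  `D²(g ∘ ‖·‖)(y)(u, w) = (g''(r) - g'(r)/r) ⟨ŷ, u⟩ ⟨ŷ, w⟩ + (g'(r)/r) ⟨u, w⟩`, for `g` of class
  `C²` near `r`.

## References

* H. B. Lawson, Jr., M.-L. Michelsohn, *Embedding and surrounding with positive mean curvature*,
  Invent. Math. 77 (1984), §3. [LawsonMichelsohn1984]
-/

noncomputable section

open Set Function Filter
open scoped Topology RealInnerProductSpace

namespace Literature.Geometry.Riemannian

variable {F : Type*} [NormedAddCommGroup F] [InnerProductSpace ℝ F]

/-- **The derivative of a radial function** `y ↦ g(‖y‖)` at `y ≠ 0`: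
`g'(‖y‖) ⟨‖y‖⁻¹ y, ·⟩`. [folklore] -/
theorem hasFDerivAt_radial {g : ℝ → ℝ} {g' : ℝ} {y : F} (hy : y ≠ 0)
    (hg : HasDerivAt g g' ‖y‖) :
    HasFDerivAt (fun z : F => g ‖z‖) (g' • innerSL ℝ (‖y‖⁻¹ • y)) y :=
  hg.comp_hasFDerivAt y (Literature.Analysis.Potential.HyperbolicBall.hasFDerivAt_norm_of_ne_zero hy)

/-- Near `y ≠ 0`, the derivative of a radial function is `z ↦ (g'(‖z‖) ‖z‖⁻¹) ⟨z, ·⟩`, provided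
`g` is differentiable at `‖z‖` for `z` near `y`. [folklore] -/
theorem fderiv_radial_eventuallyEq {g : ℝ → ℝ} {y : F} (hy : y ≠ 0)
    (hg : ∀ᶠ s in 𝓝 ‖y‖, DifferentiableAt ℝ g s) :
    (fun z : F => fderiv ℝ (fun w : F => g ‖w‖) z) =ᶠ[𝓝 y]
      fun z => (deriv g ‖z‖ * ‖z‖⁻¹) • innerSL ℝ z := by
  have hne : ∀ᶠ z in 𝓝 y, z ≠ (0 : F) := isOpen_ne.eventually_mem hy
  have hg' : ∀ᶠ z in 𝓝 y, DifferentiableAt ℝ g ‖z‖ :=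
    continuous_norm.continuousAt.eventually hg
  filter_upwards [hne, hg'] with z hz hgz
  rw [(hasFDerivAt_radial hz hgz.hasDerivAt).fderiv, map_smul, smul_smul]

/-- **The radial Hessian.**  For `g` differentiable near `r = ‖y‖` (`y ≠ 0`) with `g'`
differentiable at `r`:
`D²(g ∘ ‖·‖)(y)(u, w) = (g''(r) - g'(r)/r) ⟨ŷ, u⟩ ⟨ŷ, w⟩ + (g'(r)/r) ⟨u, w⟩`, `ŷ = r⁻¹ y`.
[folklore] -/
theorem fderiv_fderiv_radial_apply {g : ℝ → ℝ} {y : F} (hy : y ≠ 0)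
    (hg : ∀ᶠ s in 𝓝 ‖y‖, DifferentiableAt ℝ g s) (hg' : DifferentiableAt ℝ (deriv g) ‖y‖)
    (u w : F) :
    fderiv ℝ (fun z : F => fderiv ℝ (fun w : F => g ‖w‖) z) y u w =
      (deriv (deriv g) ‖y‖ - deriv g ‖y‖ / ‖y‖) * (⟪‖y‖⁻¹ • y, u⟫ * ⟪‖y‖⁻¹ • y, w⟫) +
        deriv g ‖y‖ / ‖y‖ * ⟪u, w⟫ := by
  have hpos : 0 < ‖y‖ := norm_pos_iff.2 hy
  -- the scalar factor `φ z = g'(‖z‖) ‖z‖⁻¹` and its derivative at `y`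
  have hφ₁ : HasFDerivAt (fun z : F => deriv g ‖z‖)
      (deriv (deriv g) ‖y‖ • innerSL ℝ (‖y‖⁻¹ • y)) y :=
    hasFDerivAt_radial hy hg'.hasDerivAt
  have hφ₂ : HasFDerivAt (fun z : F => ‖z‖⁻¹) ((-(‖y‖ ^ 2)⁻¹) • innerSL ℝ (‖y‖⁻¹ • y)) y :=
    hasFDerivAt_radial (g := fun s => s⁻¹) hy (hasDerivAt_inv hpos.ne')
  have hφ : HasFDerivAt (fun z : F => deriv g ‖z‖ * ‖z‖⁻¹)
      (deriv g ‖y‖ • ((-(‖y‖ ^ 2)⁻¹) • innerSL ℝ (‖y‖⁻¹ • y)) +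
        ‖y‖⁻¹ • (deriv (deriv g) ‖y‖ • innerSL ℝ (‖y‖⁻¹ • y))) y := hφ₁.mul hφ₂
  -- the derivative of `z ↦ φ z • innerSL z`
  have hL : HasFDerivAt (fun z : F => (deriv g ‖z‖ * ‖z‖⁻¹) • innerSL ℝ z)
      ((deriv g ‖y‖ * ‖y‖⁻¹) • (innerSL ℝ (E := F)) +
        (deriv g ‖y‖ • ((-(‖y‖ ^ 2)⁻¹) • innerSL ℝ (‖y‖⁻¹ • y)) +
          ‖y‖⁻¹ • (deriv (deriv g) ‖y‖ • innerSL ℝ (‖y‖⁻¹ • y))).smulRight (innerSL ℝ y)) y :=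
    hφ.smul ((innerSL ℝ (E := F)).hasFDerivAt (x := y))
  have hev := fderiv_radial_eventuallyEq hy hg
  have hmain := hL.congr_of_eventuallyEq hev
  rw [hmain.fderiv]
  have key : ∀ a b : F, (innerSL ℝ (E := F)) a b = ⟪a, b⟫ := fun a b => rfl
  simp only [add_apply, smul_apply, ContinuousLinearMap.smulRight_apply, key,
    smul_eq_mul, real_inner_smul_left]
  field_simp
  ring

/-- The derivative of a radial function is differentiable at `y ≠ 0` (under the hypotheses of
`fderiv_fderiv_radial_apply`), with derivative
`(g'(r) r⁻¹) • innerSL + (φ') ⊗ ⟨y, ·⟩`, `φ' = (g''(r) r⁻¹ - g'(r) r⁻²) ⟨ŷ, ·⟩`. [folklore] -/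
theorem hasFDerivAt_fderiv_radial {g : ℝ → ℝ} {y : F} (hy : y ≠ 0)
    (hg : ∀ᶠ s in 𝓝 ‖y‖, DifferentiableAt ℝ g s) (hg' : DifferentiableAt ℝ (deriv g) ‖y‖) :
    HasFDerivAt (fun z : F => fderiv ℝ (fun w : F => g ‖w‖) z)
      ((deriv g ‖y‖ * ‖y‖⁻¹) • (innerSL ℝ (E := F)) +
        (deriv g ‖y‖ • ((-(‖y‖ ^ 2)⁻¹) • innerSL ℝ (‖y‖⁻¹ • y)) +
          ‖y‖⁻¹ • (deriv (deriv g) ‖y‖ • innerSL ℝ (‖y‖⁻¹ • y))).smulRight (innerSL ℝ y)) y := by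
  have hpos : 0 < ‖y‖ := norm_pos_iff.2 hy
  have hφ₁ : HasFDerivAt (fun z : F => deriv g ‖z‖)
      (deriv (deriv g) ‖y‖ • innerSL ℝ (‖y‖⁻¹ • y)) y :=
    hasFDerivAt_radial hy hg'.hasDerivAt
  have hφ₂ : HasFDerivAt (fun z : F => ‖z‖⁻¹) ((-(‖y‖ ^ 2)⁻¹) • innerSL ℝ (‖y‖⁻¹ • y)) y :=
    hasFDerivAt_radial (g := fun s => s⁻¹) hy (hasDerivAt_inv hpos.ne')
  have hφ : HasFDerivAt (fun z : F => deriv g ‖z‖ * ‖z‖⁻¹)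
      (deriv g ‖y‖ • ((-(‖y‖ ^ 2)⁻¹) • innerSL ℝ (‖y‖⁻¹ • y)) +
        ‖y‖⁻¹ • (deriv (deriv g) ‖y‖ • innerSL ℝ (‖y‖⁻¹ • y))) y := hφ₁.mul hφ₂
  have hL : HasFDerivAt (fun z : F => (deriv g ‖z‖ * ‖z‖⁻¹) • innerSL ℝ z)
      ((deriv g ‖y‖ * ‖y‖⁻¹) • (innerSL ℝ (E := F)) +
        (deriv g ‖y‖ • ((-(‖y‖ ^ 2)⁻¹) • innerSL ℝ (‖y‖⁻¹ • y)) +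
          ‖y‖⁻¹ • (deriv (deriv g) ‖y‖ • innerSL ℝ (‖y‖⁻¹ • y))).smulRight (innerSL ℝ y)) y :=
    hφ.smul ((innerSL ℝ (E := F)).hasFDerivAt (x := y))
  exact hL.congr_of_eventuallyEq (fderiv_radial_eventuallyEq hy hg)

/-- The derivative of a radial function is differentiable at `y ≠ 0`. [folklore] -/
theorem differentiableAt_fderiv_radial {g : ℝ → ℝ} {y : F} (hy : y ≠ 0)
    (hg : ∀ᶠ s in 𝓝 ‖y‖, DifferentiableAt ℝ g s) (hg' : DifferentiableAt ℝ (deriv g) ‖y‖) :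
    DifferentiableAt ℝ (fun z : F => fderiv ℝ (fun w : F => g ‖w‖) z) y :=
  (hasFDerivAt_fderiv_radial hy hg hg').differentiableAt

end Literature.Geometry.Riemannian

end
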